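import Literature.MathematicalPhysics.QuantumFieldTheory.ConformalBootstrap3D.PointKernelK34L505Data
import Literature.MathematicalPhysics.QuantumFieldTheory.ConformalBootstrap3D.PointKernelK34L505Segs
import Literature.MathematicalPhysics.QuantumFieldTheory.ConformalBootstrap3D.PointKernelParts

/-!
# K34L505 certificate, kernel part file P32: one-cell head segments 99, 100 in level ranges

The head cells whose kernel evaluation exceeds one `decide` are one-cell segments of `hsegsK34L505`; each is
checked by `PCert.hPartSideOK` (side conditions) and `PCert.hPartOK` per level range `[n_lo, n_lo + count)`
against an integer claim, the claims summing to `≥ 0` (`PointKernel.partsOK`); soundness is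
`PCert.hParts_sound` (`PointKernelParts`).  The part files are mutually independent (each imports only
the data file); the ranges of one cell may span several of them, and the per-cell conclusions
`hparts_i` / `hcell_i` of those cells are assembled in `PointKernelK34L505.lean`.
Estimated kernel time 251 s.
-/

set_option maxRecDepth 100000
set_option maxHeartbeats 0

namespace Literature.MathematicalPhysics.QuantumFieldTheory.ConformalBootstrap3D.PointKernelK34L505

open Literature.MathematicalPhysics.QuantumFieldTheory.ConformalBootstrap3D.PointKernel

/-- levels `[61, 65)` of segment 99: partial lower sum `≥` claim. [folklore] -/
theorem part_99_5 : certK34L505.hPartOK (PCert.segAt hsegsK34L505 99) JHK34L505 61 4 (224440444043455525614979217666545051) = true := by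
  decide +kernel

/-- one-cell segment 100 (row 6, cell `[14339/2048, 3585/512]`, chord, `n_F = 72`,
10 level ranges): side conditions. [folklore] -/
theorem pside_100 : certK34L505.hPartSideOK (PCert.segAt hsegsK34L505 100) JHK34L505 = true := by
  decide +kernel

/-- its level ranges `(n_lo, count, claim)`. [folklore] -/
def partsK34L505_100 : List (ℕ × ℕ × ℤ) := [(0, 25, -28400921015198339132818274748086540970), (25, 11, 18299451943070064965302125721779957446), (36, 8, 5951535385621209286775246850025137976), (44, 6, 2126769574489199522511790621166730515), (50, 5, 961146546249069910539145607418848031), (55, 5, 546194169623494130864648331852672547), (60, 4, 255675280554943749049018376126098882), (64, 4, 158080826138099693413758156376414744), (68, 3, 72665126817514945809147215457371488), (71, 2, 29402162634742928553393867883309347)]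

/-- the ranges tile `[0, n_F]` and the claims sum to `≥ 0`. [folklore] -/
theorem pcov_100 : PointKernel.partsOK 72 partsK34L505_100 = true := by
  decide +kernel

/-- levels `[0, 25)` of segment 100: partial lower sum `≥` claim. [folklore] -/
theorem part_100_0 : certK34L505.hPartOK (PCert.segAt hsegsK34L505 100) JHK34L505 0 25 (-28400921015198339132818274748086540970) = true := by
  decide +kernel

/-- levels `[25, 36)` of segment 100: partial lower sum `≥` claim. [folklore] -/
theorem part_100_1 : certK34L505.hPartOK (PCert.segAt hsegsK34L505 100) JHK34L505 25 11 (18299451943070064965302125721779957446) = true := by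
  decide +kernel

/-- levels `[36, 44)` of segment 100: partial lower sum `≥` claim. [folklore] -/
theorem part_100_2 : certK34L505.hPartOK (PCert.segAt hsegsK34L505 100) JHK34L505 36 8 (5951535385621209286775246850025137976) = true := by
  decide +kernel

end Literature.MathematicalPhysics.QuantumFieldTheory.ConformalBootstrap3D.PointKernelK34L505
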